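/-
Origin: expansion seat `prover-pub-hodgecm-prl2-g2-0`, handover 2026-08-18T04:10:10Z (`HOME/pub-hodgecm-prl2-g2/lean/Prl2g2/SupplyBridge.lean`, md5 0eaa68de, 68 lines);
landed by the gen-5 packager in gate run 21 as `HodgeCM/Automorphic/SupplyBridge.lean` (import ^import Prl2g2\.SupplySplit\b→import HodgeCM.StubTree.SupplySplit ×1).
-/
/-
Origin: HOME/pub-hodgecm-prl2-g2/lean/Prl2g2/SupplyBridge.lean — session planner-pub-hodgecm-prl2-g2-0 (unit pub-hodgecm-prl2, gen 2).
Intended final place: `HodgeCM/Automorphic/SupplyBridge.lean` (imports `HodgeCM.Automorphic.ThetaWedgeSplit` — prover 1's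
theta vocabulary — and `HodgeCM.StubTree.SupplySplit` — prover 2's Uiso-level pieces).  RECONCILIATION GLUE ONLY: nothing
cited, nothing posited; two kernel-checked implications between the two provers' open inputs.
-/
import Summits.HodgeConjecture.HodgeCM.Automorphic.ThetaWedgeSplit
import Summits.HodgeConjecture.HodgeCM.StubTree.SupplySplit

set_option autoImplicit false

/-!
# Reconciliation: prover 1's `Open_supply` is prover 2's (S₀₁ᵉ) in theta vocabulary

Prover 1 (`HodgeCM.Automorphic.ThetaWedgeSplit`) asks, per good seesaw context, for ONE nonzero theta one-form of type `Ψ₀`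
and one of type `Ψ₁`, each at some level (`ThetaModel.Open_supply`), and separately that theta one-forms are isotypic
(`ThetaModel.Open_thetaSub`: `Θ_i(Γ) ⊆ U_{Ψ_i}(Γ)`).  Prover 2 (`HodgeCM.StubTree.SupplySplit`) asks for
`U_{Ψ₀}(Γ₀) ≠ 0`, `U_{Ψ₁}(Γ₁) ≠ 0` (`Universe.TypeSupplyEach01`).  The first pair implies the second
(`typeSupplyEach01_of_supply`) — so the reduction dossier's print source for supply (Liu 2021 Thm 4.18 + Prop 4.13, or the
elementary non-vanishing of one theta coefficient per type, REDUCTION-v2.md §1/§3) serves both routes, and on both routes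
NOTHING is asked of the types `Ψ₂, Ψ₃` (prover 1: `S₃₄ = S₁₂`; prover 2: `typeSupplyAt_of_supply01_freePairing`).
-/

noncomputable section

namespace HodgeCM

namespace Universe

namespace ThetaModel

variable {U : Universe} (T : U.ThetaModel)

open Literature.AlgebraicGeometry.Motives (CMType)

/-- **`Open_thetaSub ∧ Open_supply ⇒ (S₀₁ᵉ)`** in every good context: a nonzero theta one-form of type `Ψ_i` is a nonzero
element of `U_{Ψ_i}(Γ)`. -/
theorem typeSupplyEach01_of_supply (hsub : T.Open_thetaSub) (hS : T.Open_supply) {L : CMField} {ι₁ : L →+* ℂ}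
    (V : HermSpace3 L ι₁) (c : SeesawCtx L) (hc : T.GoodCtx ι₁ c) : U.TypeSupplyEach01 V c.K c.Ψ c.σ := by
  obtain ⟨⟨Γ₀, ω₀, hω₀, hne₀⟩, ⟨Γ₁, ω₁, hω₁, hne₁⟩⟩ := hS V c hc
  refine ⟨⟨Γ₀, ?_⟩, ⟨Γ₁, ?_⟩⟩
  · rw [Submodule.ne_bot_iff]
    exact ⟨ω₀, hsub V c hc 0 Γ₀ hω₀, hne₀⟩
  · rw [Submodule.ne_bot_iff]
    exact ⟨ω₁, hsub V c hc 1 Γ₁ hω₁, hne₁⟩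

/-- **`Open_thetaSub ∧ Open_thetaWedge ⇒ (S₀₁)`** (common level) in every good context: the two theta one-forms with nonzero
cup product are nonzero isotypic forms at one level. -/
theorem typeSupply01At_of_thetaWedge (hsub : T.Open_thetaSub) (hW : T.Open_thetaWedge) {L : CMField} {ι₁ : L →+* ℂ}
    (V : HermSpace3 L ι₁) (c : SeesawCtx L) (hc : T.GoodCtx ι₁ c) : U.TypeSupply01At V c.K c.Ψ c.σ := by
  obtain ⟨Γ, ω₁, hω₁, ω₂, hω₂, hcup⟩ := hW V c hc
  refine ⟨Γ, ?_, ?_⟩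
  · rw [Submodule.ne_bot_iff]
    refine ⟨ω₁, hsub V c hc 0 Γ hω₁, ?_⟩
    rintro rfl
    exact hcup (by rw [map_zero, LinearMap.zero_apply])
  · rw [Submodule.ne_bot_iff]
    refine ⟨ω₂, hsub V c hc 1 Γ hω₂, ?_⟩
    rintro rfl
    exact hcup (by rw [map_zero])

end ThetaModel

end Universe

end HodgeCM

end
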